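import Summits.RiemannHypothesis.RiemannHypothesis.Theorems.SignConeConeMagnificationCombTypeNodeMain

/-!
# Crux `SignCone.ConeMagnification` (stmt-RiemannHypothesis-16303), line `Sketch` r9, stub `stub_combType` — sharp node evaluation VIII′:
# the corner nodes, crudely

Backstop, part 8′.  `CombType.node_sharp_corner` bounds ANY node by `node_weight_pair` plus `|S| ≤ S_max = √L(2N₀L + 5N₂ + 6N₀)`
(`CombType.abs_classTerm_le`, `CombType.bump_integral_bounds`): `|V(n) − deep − smooth − S/n| ≤ (C₃ + S_max)/n + 8N₀Lh`.
-/

noncomputable section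

-- `Summit.RiemannHypothesis.RiemannHypothesis.…` repeats a namespace component by design (D-0017 layout).
set_option linter.dupNamespace false

open scoped BigOperators
open MeasureTheory Set

namespace Summit.RiemannHypothesis.RiemannHypothesis.Theorems.SignConeConeMagnification

open Literature.NumberTheory.LFunctions

namespace CombType

/-- `|∫B| ≤ 8N₀` and `|I_H| ≤ 5N₂` for the bump autocorrelation. [folklore] -/
theorem bump_integral_bounds {B B' B'' : ℝ → ℝ} {N₀ N₂ : ℝ}
    (hB : ∀ x, HasDerivAt B (B' x) x) (hB' : ∀ x, HasDerivAt B' (B'' x) x)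
    (h0 : ∀ x, |B x| ≤ N₀) (h2 : ∀ x, |B'' x| ≤ N₂) (hBs : ∀ x, 2 < |x| → B x = 0) (hB0 : ∀ x, 0 ≤ B x) :
    |∫ x, B x| ≤ 8 * N₀ ∧ |∫ v in Ioi (1 / 2 : ℝ), ((∑' m : ℤ, B (m / v)) - v * ∫ x, B x) / v| ≤ 5 * N₂ := by
  constructor
  · have h := toothBeta_le (h := 0) hB0 h0 hBs le_rfl (by norm_num)
    have h' := toothBeta_nonneg hB0 (0 : ℝ)
    simp only [zero_mul, neg_zero, zero_div, Real.exp_zero, mul_one] at h h'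
    rw [abs_of_nonneg h']; exact h
  · have := abs_integral_periodizationH_Ioi_le hB hB' h2 hBs (le_refl (1 / 2 : ℝ))
    refine this.trans (le_of_eq ?_); norm_num

/-- **The class term is bounded**: `|S(δ)| ≤ √L(2N₀L + 5N₂ + 6N₀)` for `δ ≤ ℓ ≤ L` (`S` as in `node_sharp_main_raw`). [folklore] -/
theorem abs_classTerm_le {B B' B'' : ℝ → ℝ} {N₀ N₂ h : ℝ} {ℓ ℓ' L δ : ℕ}
    (hB : ∀ x, HasDerivAt B (B' x) x) (hB' : ∀ x, HasDerivAt B' (B'' x) x)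
    (h0 : ∀ x, |B x| ≤ N₀) (h2 : ∀ x, |B'' x| ≤ N₂) (hBs : ∀ x, 2 < |x| → B x = 0) (hB0 : ∀ x, 0 ≤ B x)
    (hℓ : 1 ≤ ℓ) (hℓL : ℓ ≤ L) (hℓ' : 1 ≤ ℓ') (hℓ'L : ℓ' ≤ L) (hδ : δ ≤ ℓ) (hh : 0 ≤ h) (hh4 : h ≤ 1 / 4) :
    |(Real.sqrt ℓ / Real.sqrt ℓ') * ((δ : ℝ) / ℓ) *
          (B 0 * Real.log (2 * (δ : ℝ)) + (∫ v in Ioi (1 / 2 : ℝ), ((∑' m : ℤ, B (m / v)) - v * ∫ x, B x) / v)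
            - (∫ x, B x) / 2)
        + (∫ v, B v * Real.exp (-(h * v) / 2)) * (Real.sqrt ℓ' / Real.sqrt ℓ) / (4 * ℓ')|
      ≤ Real.sqrt L * (2 * N₀ * L + 5 * N₂ + 6 * N₀) := by
  have hN₀ : 0 ≤ N₀ := (abs_nonneg _).trans (h0 0)
  have hN₂ : 0 ≤ N₂ := (abs_nonneg _).trans (h2 0)
  obtain ⟨hiB, hIH⟩ := bump_integral_bounds hB hB' h0 h2 hBs hB0
  have hβ8 := toothBeta_le hB0 h0 hBs hh hh4
  have hβ0 := toothBeta_nonneg hB0 h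
  have hℓR : (1 : ℝ) ≤ ℓ := by exact_mod_cast hℓ
  have hℓ'R : (1 : ℝ) ≤ ℓ' := by exact_mod_cast hℓ'
  have hLR : (1 : ℝ) ≤ L := by exact_mod_cast (le_trans hℓ hℓL)
  have hℓLR : (ℓ : ℝ) ≤ L := by exact_mod_cast hℓL
  have hℓ'LR : (ℓ' : ℝ) ≤ L := by exact_mod_cast hℓ'L
  have hδℓ : (δ : ℝ) ≤ ℓ := by exact_mod_cast hδ
  have hℓ0 : (0 : ℝ) < ℓ := by linarith
  -- `√ℓ/√ℓ' ≤ √L` and `√ℓ'/√ℓ ≤ √L`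
  have hsL : ∀ (a b : ℕ), 1 ≤ a → a ≤ L → 1 ≤ b → Real.sqrt a / Real.sqrt b ≤ Real.sqrt L := by
    intro a b ha haL hb
    have haR : (a : ℝ) ≤ L := by exact_mod_cast haL
    have hbR : (1 : ℝ) ≤ b := by exact_mod_cast hb
    have h1 : Real.sqrt (a : ℝ) ≤ Real.sqrt L := Real.sqrt_le_sqrt haR
    have h2 : 1 ≤ Real.sqrt (b : ℝ) := by rw [Real.le_sqrt' one_pos, one_pow]; exact hbR
    calc Real.sqrt a / Real.sqrt b ≤ Real.sqrt a / 1 := div_le_div_of_nonneg_left (Real.sqrt_nonneg _) one_pos h2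
      _ ≤ Real.sqrt L := by rw [div_one]; exact h1
  have hρ := hsL ℓ ℓ' hℓ hℓL hℓ'
  have hρ' := hsL ℓ' ℓ hℓ' hℓ'L hℓ
  have hρ0 : 0 ≤ Real.sqrt ℓ / Real.sqrt ℓ' := by positivity
  have hρ'0 : 0 ≤ Real.sqrt ℓ' / Real.sqrt ℓ := by positivity
  have hsL1 : 1 ≤ Real.sqrt (L : ℝ) := by rw [Real.le_sqrt' one_pos, one_pow]; exact hLR
  -- `|log(2δ)| ≤ 2L`
  have hlog : |Real.log (2 * (δ : ℝ))| ≤ 2 * L := by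
    rcases Nat.eq_zero_or_pos δ with hz | hpos
    · subst hz
      simp only [Nat.cast_zero, mul_zero, Real.log_zero, abs_zero]
      positivity
    · have hδR : (1 : ℝ) ≤ δ := by exact_mod_cast hpos
      have hpos' : (0 : ℝ) < 2 * δ := by linarith
      rw [abs_of_nonneg (Real.log_nonneg (by linarith))]
      have := Real.log_le_sub_one_of_pos hpos'
      linarith
  have hδ1 : (δ : ℝ) / ℓ ≤ 1 := by rw [div_le_one hℓ0]; exact hδℓ
  have hδ0 : 0 ≤ (δ : ℝ) / ℓ := by positivity
  -- the bracket
  have hbr : |B 0 * Real.log (2 * (δ : ℝ)) + (∫ v in Ioi (1 / 2 : ℝ), ((∑' m : ℤ, B (m / v)) - v * ∫ x, B x) / v)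
      - (∫ x, B x) / 2| ≤ N₀ * (2 * L) + 5 * N₂ + 4 * N₀ := by
    have hB0' : |B 0| ≤ N₀ := h0 0
    have t1 : |B 0 * Real.log (2 * (δ : ℝ))| ≤ N₀ * (2 * L) := by
      rw [abs_mul]; exact mul_le_mul hB0' hlog (abs_nonneg _) hN₀
    have t3 : |(∫ x, B x) / 2| ≤ 4 * N₀ := by rw [abs_div, abs_two]; linarith
    calc _ ≤ |B 0 * Real.log (2 * (δ : ℝ)) + (∫ v in Ioi (1 / 2 : ℝ), ((∑' m : ℤ, B (m / v)) - v * ∫ x, B x) / v)|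
          + |(∫ x, B x) / 2| := abs_sub _ _
      _ ≤ (|B 0 * Real.log (2 * (δ : ℝ))| + |∫ v in Ioi (1 / 2 : ℝ), ((∑' m : ℤ, B (m / v)) - v * ∫ x, B x) / v|)
          + |(∫ x, B x) / 2| := add_le_add (abs_add_le _ _) le_rfl
      _ ≤ (N₀ * (2 * L) + 5 * N₂) + 4 * N₀ := add_le_add (add_le_add t1 hIH) t3
      _ = _ := by ring
  have hfirst : |(Real.sqrt ℓ / Real.sqrt ℓ') * ((δ : ℝ) / ℓ) *
      (B 0 * Real.log (2 * (δ : ℝ)) + (∫ v in Ioi (1 / 2 : ℝ), ((∑' m : ℤ, B (m / v)) - v * ∫ x, B x) / v) - (∫ x, B x) / 2)|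
      ≤ Real.sqrt L * (N₀ * (2 * L) + 5 * N₂ + 4 * N₀) := by
    rw [abs_mul, abs_mul, abs_of_nonneg hρ0, abs_of_nonneg hδ0]
    calc Real.sqrt ℓ / Real.sqrt ℓ' * ((δ : ℝ) / ℓ) * |_| ≤ Real.sqrt L * 1 * (N₀ * (2 * L) + 5 * N₂ + 4 * N₀) :=
          mul_le_mul (mul_le_mul hρ hδ1 hδ0 (Real.sqrt_nonneg _)) hbr (abs_nonneg _) (by positivity)
      _ = _ := by ring
  have hsecond : |(∫ v, B v * Real.exp (-(h * v) / 2)) * (Real.sqrt ℓ' / Real.sqrt ℓ) / (4 * ℓ')| ≤ Real.sqrt L * (2 * N₀) := by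
    rw [abs_div, abs_mul, abs_of_nonneg hβ0, abs_of_nonneg hρ'0, abs_of_pos (by positivity : (0 : ℝ) < 4 * ℓ')]
    rw [div_le_iff₀ (by positivity)]
    calc (∫ v, B v * Real.exp (-(h * v) / 2)) * (Real.sqrt ℓ' / Real.sqrt ℓ) ≤ 8 * N₀ * Real.sqrt L :=
          mul_le_mul hβ8 hρ' hρ'0 (by positivity)
      _ = Real.sqrt L * (2 * N₀) * (4 * 1) := by ring
      _ ≤ Real.sqrt L * (2 * N₀) * (4 * ℓ') := by
          refine mul_le_mul_of_nonneg_left (by linarith) (by positivity)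
  calc _ ≤ _ := abs_add_le _ _
    _ ≤ Real.sqrt L * (N₀ * (2 * L) + 5 * N₂ + 4 * N₀) + Real.sqrt L * (2 * N₀) := add_le_add hfirst hsecond
    _ = Real.sqrt L * (2 * N₀ * L + 5 * N₂ + 6 * N₀) := by ring

/-- **Any node, crudely** (for the corners): `node_weight_pair` plus the bound on the class term. [folklore] -/
theorem node_sharp_corner {B B' B'' : ℝ → ℝ} {N₀ N₁ N₂ h : ℝ} {L ℓ ℓ' M n : ℕ}
    (hB : ∀ x, HasDerivAt B (B' x) x) (hB' : ∀ x, HasDerivAt B' (B'' x) x)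
    (h0 : ∀ x, |B x| ≤ N₀) (h1 : ∀ x, |B' x| ≤ N₁) (h2 : ∀ x, |B'' x| ≤ N₂)
    (hBs : ∀ x, 2 < |x| → B x = 0) (hB0 : ∀ x, 0 ≤ B x)
    (hL : 1 ≤ L) (hℓ : 1 ≤ ℓ) (hℓL : ℓ ≤ L) (hℓ' : 1 ≤ ℓ') (hℓ'L : ℓ' ≤ L) (hn : 1 ≤ n)
    (hh : 0 < h) (hhL : h ≤ 1 / (32 * L)) (hhM : 1 ≤ h * M) (hhM2 : h ^ 2 * M ≤ 1) :
    |(∑ k' ∈ Finset.Icc 1 M,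
        (∑ k ∈ Finset.Icc 1 M, B ((Real.log ((n : ℝ) * ℓ' * k' / ℓ) - Real.log k) / h) / Real.sqrt k)
          / Real.sqrt k' / Real.sqrt n)
      - B 0 * (Real.sqrt ℓ / Real.sqrt ℓ') *
          (∑ k' ∈ Finset.Icc 1 ⌊1 / (4 * h) / ((n : ℝ) * ℓ')⌋₊,
            (if ℓ ∣ n * ℓ' * k' then 1 / (k' : ℝ) else 0)) / n
      - h * (∫ v, B v * Real.exp (-(h * v) / 2)) * (Real.sqrt ℓ' / Real.sqrt ℓ) *
          ((min M ⌊(ℓ : ℝ) * M * Real.exp (-(2 * h)) / (ℓ' * n)⌋₊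
              - ⌊1 / (4 * h) / ((n : ℝ) * ℓ')⌋₊ : ℕ) : ℝ)
      - ((Real.sqrt ℓ / Real.sqrt ℓ') * ((Nat.gcd (n * ℓ') ℓ : ℝ) / ℓ) *
            (B 0 * Real.log (2 * (Nat.gcd (n * ℓ') ℓ : ℝ))
              + (∫ v in Ioi (1 / 2 : ℝ), ((∑' m : ℤ, B (m / v)) - v * ∫ x, B x) / v) - (∫ x, B x) / 2)
          + (∫ v, B v * Real.exp (-(h * v) / 2)) * (Real.sqrt ℓ' / Real.sqrt ℓ) / (4 * ℓ')) / n|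
      ≤ ((8 * ((N₀ + 2 * N₁ + N₂) * (96 + 192 * L) * L ^ 2) * L + 64 * N₀ * L ^ 2)
          + Real.sqrt L * (2 * N₀ * L + 5 * N₂ + 6 * N₀)) / n + 8 * N₀ * L * h := by
  have hLR : (1 : ℝ) ≤ L := by exact_mod_cast hL
  have hnR : (1 : ℝ) ≤ n := by exact_mod_cast hn
  have hn0 : (0 : ℝ) < n := by linarith
  have h32 : 1 / (32 * (L : ℝ)) ≤ 1 / 32 := one_div_le_one_div_of_le (by norm_num) (by linarith)
  have hh4 : h ≤ 1 / 4 := by linarith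
  have hnode := node_weight_pair (M := M) hB hB' h0 h1 h2 hBs hB0 hL hℓ hℓL hℓ' hℓ'L hn hh hhL hhM hhM2
  have hS := abs_classTerm_le (h := h) (δ := Nat.gcd (n * ℓ') ℓ) hB hB' h0 h2 hBs hB0 hℓ hℓL hℓ' hℓ'L
    (Nat.gcd_le_right _ (by omega)) hh.le hh4
  have hSn : |((Real.sqrt ℓ / Real.sqrt ℓ') * ((Nat.gcd (n * ℓ') ℓ : ℝ) / ℓ) *
            (B 0 * Real.log (2 * (Nat.gcd (n * ℓ') ℓ : ℝ))
              + (∫ v in Ioi (1 / 2 : ℝ), ((∑' m : ℤ, B (m / v)) - v * ∫ x, B x) / v) - (∫ x, B x) / 2)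
          + (∫ v, B v * Real.exp (-(h * v) / 2)) * (Real.sqrt ℓ' / Real.sqrt ℓ) / (4 * ℓ')) / n|
      ≤ Real.sqrt L * (2 * N₀ * L + 5 * N₂ + 6 * N₀) / n := by
    rw [abs_div, abs_of_pos hn0]
    exact div_le_div_of_nonneg_right hS hn0.le
  calc _ ≤ _ := abs_sub _ _
    _ ≤ ((8 * ((N₀ + 2 * N₁ + N₂) * (96 + 192 * L) * L ^ 2) * L + 64 * N₀ * L ^ 2) / n + 8 * N₀ * L * h)
        + Real.sqrt L * (2 * N₀ * L + 5 * N₂ + 6 * N₀) / n := add_le_add hnode hSn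
    _ = _ := by ring

/-- **Anchor `combTypeNodeSharpCorner`** (registered sub-goal; `node_sharp_corner` with explicit quantifiers). [folklore] -/
theorem combTypeNodeSharpCorner : ∀ B B' B'' : ℝ → ℝ, ∀ N₀ N₁ N₂ h : ℝ, ∀ L ℓ ℓ' M n : ℕ, (∀ x, HasDerivAt B (B' x) x) → (∀ x, HasDerivAt B' (B'' x) x) → (∀ x, |B x| ≤ N₀) → (∀ x, |B' x| ≤ N₁) → (∀ x, |B'' x| ≤ N₂) → (∀ x, 2 < |x| → B x = 0) → (∀ x, 0 ≤ B x) → (1 ≤ L) → (1 ≤ ℓ) → (ℓ ≤ L) → (1 ≤ ℓ') → (ℓ' ≤ L) → (1 ≤ n) → (0 < h) → (h ≤ 1 / (32 * L)) → (1 ≤ h * M) → (h ^ 2 * M ≤ 1) → |(∑ k' ∈ Finset.Icc 1 M, (∑ k ∈ Finset.Icc 1 M, B ((Real.log ((n : ℝ) * ℓ' * k' / ℓ) - Real.log k) / h) / Real.sqrt k) / Real.sqrt k' / Real.sqrt n) - B 0 * (Real.sqrt ℓ / Real.sqrt ℓ') * (∑ k' ∈ Finset.Icc 1 ⌊1 /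 (4 * h) / ((n : ℝ) * ℓ')⌋₊, (if ℓ ∣ n * ℓ' * k' then 1 / (k' : ℝ) else 0)) / n - h * (∫ v, B v * Real.exp (-(h * v) / 2)) * (Real.sqrt ℓ' / Real.sqrt ℓ) * ((min M ⌊(ℓ : ℝ) * M * Real.exp (-(2 * h)) / (ℓ' * n)⌋₊ - ⌊1 / (4 * h) / ((n : ℝ) * ℓ')⌋₊ : ℕ) : ℝ) - ((Real.sqrt ℓ / Real.sqrt ℓ') * ((Nat.gcd (n * ℓ') ℓ : ℝ) / ℓ) * (B 0 * Real.log (2 * (Nat.gcd (n * ℓ') ℓ : ℝ)) + (∫ v in Set.Ioi (1 / 2 : ℝ), ((∑' m : ℤ, B (m / v)) - v * ∫ x, B x) / v) - (∫ x, B x) / 2) + (∫ v, B v * Real.exp (-(h * v) / 2)) * (Real.sqrt ℓ' / Real.sqrt ℓ) / (4 * ℓ')) / n| ≤ ((8 * ((N₀ + 2 * N₁ + N₂) * (96 + 192 * L) * L ^ 2) * L + 64 * N₀ * L ^ 2) + Real.sqrt L * (2 * N₀ * L + 5 * N₂ + 6 * N₀)) / n + 8 * N₀ * L * h :=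
  fun _ _ _ _ _ _ _ _ _ _ _ _ hB hB' h0 h1 h2 hBs hB0 hL hℓ hℓL hℓ' hℓ'L hn hh hhL hhM hhM2 =>
    node_sharp_corner hB hB' h0 h1 h2 hBs hB0 hL hℓ hℓL hℓ' hℓ'L hn hh hhL hhM hhM2

end CombType

end Summit.RiemannHypothesis.RiemannHypothesis.Theorems.SignConeConeMagnification

end
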